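import Summits.Schanuel.Schanuel.Theses.RoyCriterion
import Summits.Schanuel.Schanuel.Theorems.RoyCriterionRankOne

/-!
# Schanuel / RoyCriterion — item `SchanuelRankOneOfHermiteLindemann` (stmt-Schanuel-0466), closed

Route `Schanuel/RoyCriterion`, support item stmt-Schanuel-0466 (encoding check of
`Literature.NumberTheory.Transcendental.SchanuelRank`): the Hermite–Lindemann named fact
`Literature.NumberTheory.Transcendental.transcendental_exp` (`α ≠ 0` algebraic ⇒ `e^α`
transcendental) implies Schanuel's conjecture in rank `1` in Roy's format, `SchanuelRank 1`.

The mathematics is already in tree as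
`Literature.Transcend.schanuelRank_one_of_transcendental_exp`
(`Theorems/RoyCriterionRankOne.lean`: if `y 0 ≠ 0` then one of `y 0`, `e^{y 0}` is transcendental
and lies in `ℚ(y 0, e^{y 0})`, so that field has positive transcendence degree over `ℚ`). This file
only restates it with the route decl
`Summit.Schanuel.Schanuel.Theses.RoyCriterion.SchanuelRankOneOfHermiteLindemann` as its TYPE, so
that the gate can close the item. Since Hermite–Lindemann is discharged in tree
(`Literature.NumberTheory.Transcendental.transcendental_exp_holds`), the conclusion `SchanuelRank 1`
is in fact unconditional. Sources: Lindemann 1882; Roy 2001 (Acta Arith. 97, 183–194), remark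
after Conjecture 1 ("known to be true when l = 1 (Hermite–Lindemann theorem)").
-/

set_option linter.dupNamespace false

namespace Summit.Schanuel.Schanuel.Theorems

/-- Closes item stmt-Schanuel-0466: the route decl
`RoyCriterion.SchanuelRankOneOfHermiteLindemann`, i.e.
`transcendental_exp → SchanuelRank 1` (Hermite–Lindemann ⇒ Schanuel's conjecture in rank one, in
Roy's format). Proof: the decl unfolds verbatim to the type of
`Literature.Transcend.schanuelRank_one_of_transcendental_exp`. [folklore; Roy 2001 §1] -/
theorem schanuelRankOneOfHermiteLindemann_proof :
    Summit.Schanuel.Schanuel.Theses.RoyCriterion.SchanuelRankOneOfHermiteLindemann := by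
  unfold Summit.Schanuel.Schanuel.Theses.RoyCriterion.SchanuelRankOneOfHermiteLindemann
  exact Literature.Transcend.schanuelRank_one_of_transcendental_exp

end Summit.Schanuel.Schanuel.Theorems
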